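import Literature.NumberTheory.Transcendental.MZVWordShuffleProofs
import Literature.NumberTheory.Transcendental.MultipleZetaRepeatedTwosProofs
import Mathlib.Data.Nat.Choose.Sum
import Mathlib.Data.Complex.BigOperators
import HarnessLib

/-!
# Multiple zeta values — the Zagier–Broadhurst evaluation `ζ({3,1}ⁿ) = 2π⁴ⁿ/(4n+2)!`

Sibling proof file of `Literature.NumberTheory.Transcendental.MultipleZetaValues` (D-0014), in the
cone of the named fact `hoffmanSpan_eq_mzvSpace` (Brown 2012, Theorem 1.1). It proves, for EVERY
`n`, the evaluation conjectured by Zagier (ECM 1992, §9, from numerics) and proved by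
Borwein–Bradley–Broadhurst–Lisoněk,

* `multipleZeta_threeOne` : `ζ({3,1}ⁿ) = ζ(3,1,3,1,…,3,1) = 2 π⁴ⁿ / (4n+2)!`
  (Borwein–Bradley–Broadhurst–Lisoněk 1998, Theorem 1 "The Zagier Conjecture"),

following the COMBINATORIAL proof of [BBBL1998, §6]: (1) the shuffle-algebra identity
(Corollary 1 of [BBBL1998, §4])
`∑_{r=-n}^{n} (-1)ʳ (AB)^{n-r} ш (AB)^{n+r} = 4ⁿ (A²B²)ⁿ` in `ℚ⟨A,B⟩`
(`MZV.sum_shuffleWord_twos_alternating`); (2) the shuffle product formula for iterated integrals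
`ζ(s) ζ(t) = ∑_{W ∈ ε(s) ш ε(t)} ζ(W)` (tree: `multipleZeta_mul_eq_sum_shuffleWord`, with
`ε({2}ᵖ) = (AB)ᵖ`, `ε({3,1}ⁿ) = (A²B²)ⁿ`, `A = 0 = dt/t`, `B = 1 = dt/(1-t)`), giving
`∑_{r} (-1)ʳ ζ({2}^{n-r}) ζ({2}^{n+r}) = 4ⁿ ζ({3,1}ⁿ)` (`sum_multipleZeta_twos_alternating`);
(3) `ζ({2}ᵏ) = π^{2k}/(2k+1)!` (`multipleZeta_replicate_two`, Hoffman 1992 / Brown (3.7)); and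
(4) the factorial identity `∑_{r=-n}^{n} (-1)ʳ/((2n+2r+1)!(2n-2r+1)!) = 2^{2n+1}/(4n+2)!`
([BBBL1998, Lemma 1]; here from `Im (1+i)^{4n+2}`).

Deviation from the source: [BBBL1998] derive Corollary 1 from an explicit multiplicity formula
for `(AB)ᵖ ш (AB)^q` (Proposition 1, a colouring count); we prove Corollary 1 instead by a direct
induction on `p + q` from the first-letter recursion `(au) ш (bv) = a(u ш bv) + b(au ш v)` of the
shuffle product (`MZV.shuffleWord_cons_cons`): writing `σ_m = ∑_{p+q=m} (-1)^q (AB)ᵖ ш (AB)^q`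
and `π_m = ∑_{p+q=m} (-1)^q B(AB)ᵖ ш B(AB)^q`, the recursion gives `π_m = 2 B² σ_m` and
`σ_{m+2} = -4 A²B² σ_m`, `σ₀ = 1`, `σ₁ = 0` (all identities are stated for the sums of an
arbitrary function `f : List Bool → ℝ` over the shuffle lists, prefixes acting by composition).

Consequences (all weights): `ζ({3,1}ⁿ) ∈ ℚ π⁴ⁿ ⊆ hoffmanSpan (4n)`
(`multipleZeta_threeOne_mem_hoffmanSpan`) — Brown's theorem `hoffmanSpan_eq_mzvSpace` for the
family `ζ(3,1,…,3,1)`, which are not Hoffman elements.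

No new definitions and no named facts are introduced (pure proofs, D-0026).

## References

* J. M. Borwein, D. M. Bradley, D. J. Broadhurst, P. Lisoněk, *Combinatorial aspects of multiple
  zeta values*, Electron. J. Combin. **5** (1998), R38 (arXiv:math/9812020): Lemma 1, §4
  Proposition 1 and Corollary 1, §6 Theorem 1. [BBBL1998]
* D. Zagier, *Values of zeta functions and their applications*, ECM Paris 1992, Progr. Math. 120
  (1994), 497–512, §9 (the conjecture `ζ(3,1,…,3,1) = 2π⁴ⁿ/(4n+2)!`). [ZagierECM1994]
* F. Brown, *Mixed Tate motives over ℤ*, Ann. of Math. **175** (2012), 949–976, Theorem 1.1.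
  [Brown2012]
-/

noncomputable section

open scoped BigOperators Nat
open Real

namespace Literature.NumberTheory.Transcendental

namespace MZV

/-! ### The words `(AB)ᵖ = ε({2}ᵖ)` and `(A²B²)ⁿ = ε({3,1}ⁿ)` -/

/-- `ε({2}⁰) = ∅`. [folklore] -/
@[simp] theorem binaryWord_replicate_two_zero : binaryWord (List.replicate 0 2) = [] := rfl

/-- `ε({2}ᵖ⁺¹) = A B ε({2}ᵖ)` (`A = 0`, `B = 1`). [folklore] -/
theorem binaryWord_replicate_two_succ (p : ℕ) :
    binaryWord (List.replicate (p + 1) 2) = false :: true :: binaryWord (List.replicate p 2) := rfl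

/-- The index `{3,1}ⁿ⁺¹ = (3, 1, {3,1}ⁿ)`. [folklore] -/
theorem threeOne_succ (n : ℕ) :
    (List.replicate (n + 1) [3, 1]).flatten = 3 :: 1 :: (List.replicate n [3, 1]).flatten := rfl

/-- `ε({3,1}ⁿ⁺¹) = A A B B ε({3,1}ⁿ)`. [folklore] -/
theorem binaryWord_threeOne_succ (n : ℕ) :
    binaryWord ((List.replicate (n + 1) [3, 1]).flatten) =
      false :: false :: true :: true :: binaryWord ((List.replicate n [3, 1]).flatten) := rfl

/-! ### The first-letter recursions for the shuffles of `(AB)ᵖ`, `B(AB)ᵖ` -/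

section ShuffleSums

variable (f : List Bool → ℝ)

/-- Summing `f` over `L.map (a :: ·)` is summing `f ∘ (a :: ·)` over `L`. [folklore] -/
theorem sum_map_map_cons (a : Bool) (L : List (List Bool)) :
    ((L.map (List.cons a)).map f).sum = (L.map (f ∘ List.cons a)).sum := by
  rw [List.map_map]

/-- (I) `(AB)ᵖ⁺¹ ш (AB)^{q+1} = AB[(AB)ᵖ ш (AB)^{q+1} + (AB)ᵖ⁺¹ ш (AB)^q] + 2 A²[B(AB)ᵖ ш B(AB)^q]`.
[cite: BBBL1998, §4 (proof of Proposition 1)] -/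
theorem sum_shuffleWord_twos_succ_succ (p q : ℕ) :
    ((shuffleWord (binaryWord (List.replicate (p + 1) 2)) (binaryWord (List.replicate (q + 1) 2))).map f).sum =
      ((shuffleWord (binaryWord (List.replicate p 2)) (binaryWord (List.replicate (q + 1) 2))).map
          (f ∘ List.cons false ∘ List.cons true)).sum +
      ((shuffleWord (binaryWord (List.replicate (p + 1) 2)) (binaryWord (List.replicate q 2))).map
          (f ∘ List.cons false ∘ List.cons true)).sum +
      2 * ((shuffleWord (true :: binaryWord (List.replicate p 2)) (true :: binaryWord (List.replicate q 2))).map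
          (f ∘ List.cons false ∘ List.cons false)).sum := by
  simp only [binaryWord_replicate_two_succ, shuffleWord_cons_cons, List.map_append, List.sum_append,
    List.map_map]
  simp only [Function.comp_def]
  ring

/-- (II) `B(AB)ᵖ ш B(AB)^q = B[(AB)ᵖ ш B(AB)^q] + B[B(AB)ᵖ ш (AB)^q]`. [folklore] -/
theorem sum_shuffleWord_B_twos (p q : ℕ) :
    ((shuffleWord (true :: binaryWord (List.replicate p 2)) (true :: binaryWord (List.replicate q 2))).map f).sum =
      ((shuffleWord (binaryWord (List.replicate p 2)) (true :: binaryWord (List.replicate q 2))).map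
          (f ∘ List.cons true)).sum +
      ((shuffleWord (true :: binaryWord (List.replicate p 2)) (binaryWord (List.replicate q 2))).map
          (f ∘ List.cons true)).sum := by
  rw [shuffleWord_cons_cons, List.map_append, List.sum_append, List.map_map, List.map_map]

/-- (III) `(AB)ᵖ⁺¹ ш B(AB)^q = A[B(AB)ᵖ ш B(AB)^q] + B[(AB)ᵖ⁺¹ ш (AB)^q]`. [folklore] -/
theorem sum_shuffleWord_twos_succ_B (p q : ℕ) :
    ((shuffleWord (binaryWord (List.replicate (p + 1) 2)) (true :: binaryWord (List.replicate q 2))).map f).sum =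
      ((shuffleWord (true :: binaryWord (List.replicate p 2)) (true :: binaryWord (List.replicate q 2))).map
          (f ∘ List.cons false)).sum +
      ((shuffleWord (binaryWord (List.replicate (p + 1) 2)) (binaryWord (List.replicate q 2))).map
          (f ∘ List.cons true)).sum := by
  rw [binaryWord_replicate_two_succ, shuffleWord_cons_cons, List.map_append, List.sum_append,
    List.map_map, List.map_map]

/-- (III') `B(AB)ᵖ ш (AB)^{q+1} = B[(AB)ᵖ ш (AB)^{q+1}] + A[B(AB)ᵖ ш B(AB)^q]`. [folklore] -/
theorem sum_shuffleWord_B_twos_succ (p q : ℕ) :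
    ((shuffleWord (true :: binaryWord (List.replicate p 2)) (binaryWord (List.replicate (q + 1) 2))).map f).sum =
      ((shuffleWord (binaryWord (List.replicate p 2)) (binaryWord (List.replicate (q + 1) 2))).map
          (f ∘ List.cons true)).sum +
      ((shuffleWord (true :: binaryWord (List.replicate p 2)) (true :: binaryWord (List.replicate q 2))).map
          (f ∘ List.cons false)).sum := by
  conv_lhs => rw [binaryWord_replicate_two_succ, shuffleWord_cons_cons]
  rw [List.map_append, List.sum_append, List.map_map, List.map_map, ← binaryWord_replicate_two_succ]

/-! ### The alternating sums `σ_m`, `π_m` over `p + q = m` -/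

/-- `∑_{q ≤ m} (-1)^q [(AB)^{m-q} ш B(AB)^q]` in terms of `π_{m-1}` and `σ_m`. [folklore] -/
theorem sum_alternating_T (m : ℕ) :
    ∑ q ∈ Finset.range (m + 1), (-1 : ℝ) ^ q *
        ((shuffleWord (binaryWord (List.replicate (m - q) 2))
          (true :: binaryWord (List.replicate q 2))).map f).sum =
      ∑ q ∈ Finset.range m, (-1 : ℝ) ^ q *
          ((shuffleWord (true :: binaryWord (List.replicate (m - 1 - q) 2))
            (true :: binaryWord (List.replicate q 2))).map (f ∘ List.cons false)).sum +
        ∑ q ∈ Finset.range (m + 1), (-1 : ℝ) ^ q *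
          ((shuffleWord (binaryWord (List.replicate (m - q) 2))
            (binaryWord (List.replicate q 2))).map (f ∘ List.cons true)).sum := by
  rw [Finset.sum_range_succ, Finset.sum_range_succ, Nat.sub_self, binaryWord_replicate_two_zero,
    shuffleWord_nil_left, shuffleWord_nil_left, List.map_singleton, List.map_singleton,
    List.sum_singleton, List.sum_singleton, Function.comp_apply, ← add_assoc, ← Finset.sum_add_distrib]
  congr 1
  refine Finset.sum_congr rfl fun q hq => ?_
  rw [Finset.mem_range] at hq
  rw [show m - q = m - 1 - q + 1 by omega, sum_shuffleWord_twos_succ_B]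
  ring

/-- `∑_{q ≤ m} (-1)^q [B(AB)^{m-q} ш (AB)^q]` in terms of `σ_m` and `π_{m-1}`. [folklore] -/
theorem sum_alternating_T' (m : ℕ) :
    ∑ q ∈ Finset.range (m + 1), (-1 : ℝ) ^ q *
        ((shuffleWord (true :: binaryWord (List.replicate (m - q) 2))
          (binaryWord (List.replicate q 2))).map f).sum =
      ∑ q ∈ Finset.range (m + 1), (-1 : ℝ) ^ q *
          ((shuffleWord (binaryWord (List.replicate (m - q) 2))
            (binaryWord (List.replicate q 2))).map (f ∘ List.cons true)).sum -
        ∑ q ∈ Finset.range m, (-1 : ℝ) ^ q *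
          ((shuffleWord (true :: binaryWord (List.replicate (m - 1 - q) 2))
            (true :: binaryWord (List.replicate q 2))).map (f ∘ List.cons false)).sum := by
  rw [Finset.sum_range_succ', Finset.sum_range_succ' (fun q => (-1 : ℝ) ^ q *
    ((shuffleWord (binaryWord (List.replicate (m - q) 2))
      (binaryWord (List.replicate q 2))).map (f ∘ List.cons true)).sum)]
  simp only [Nat.sub_zero, binaryWord_replicate_two_zero, shuffleWord_nil_right, List.map_singleton,
    List.sum_singleton, Function.comp_apply, pow_zero, one_mul]
  have h : ∀ q ∈ Finset.range m, (-1 : ℝ) ^ (q + 1) *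
      ((shuffleWord (true :: binaryWord (List.replicate (m - (q + 1)) 2))
        (binaryWord (List.replicate (q + 1) 2))).map f).sum =
      (-1 : ℝ) ^ (q + 1) * ((shuffleWord (binaryWord (List.replicate (m - (q + 1)) 2))
        (binaryWord (List.replicate (q + 1) 2))).map (f ∘ List.cons true)).sum -
      (-1 : ℝ) ^ q * ((shuffleWord (true :: binaryWord (List.replicate (m - 1 - q) 2))
        (true :: binaryWord (List.replicate q 2))).map (f ∘ List.cons false)).sum := by
    intro q hq
    rw [sum_shuffleWord_B_twos_succ, show m - (q + 1) = m - 1 - q by omega]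
    ring
  rw [Finset.sum_congr rfl h, Finset.sum_sub_distrib]
  ring

/-- **`π_m = 2 B² σ_m`**: `∑_{q ≤ m} (-1)^q [B(AB)^{m-q} ш B(AB)^q] = 2 ∑_{q ≤ m} (-1)^q B²[(AB)^{m-q} ш (AB)^q]`.
[cite: BBBL1998, §4 Corollary 1] -/
theorem sum_alternating_P (m : ℕ) :
    ∑ q ∈ Finset.range (m + 1), (-1 : ℝ) ^ q *
        ((shuffleWord (true :: binaryWord (List.replicate (m - q) 2))
          (true :: binaryWord (List.replicate q 2))).map f).sum =
      2 * ∑ q ∈ Finset.range (m + 1), (-1 : ℝ) ^ q *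
          ((shuffleWord (binaryWord (List.replicate (m - q) 2))
            (binaryWord (List.replicate q 2))).map (f ∘ List.cons true ∘ List.cons true)).sum := by
  simp only [sum_shuffleWord_B_twos, mul_add, Finset.sum_add_distrib]
  rw [sum_alternating_T (f ∘ List.cons true) m, sum_alternating_T' (f ∘ List.cons true) m]
  simp only [Function.comp_assoc]
  ring

/-- The abstract telescoping behind `σ_{m+2} = -4 A²B² σ_m`: if `s(a+1,b+1) = s₁(a,b+1) + s₁(a+1,b)
+ 2 p(a,b)` and the four boundary values `s(m+2,0) = s(0,m+2) = s₁(m+1,0) = s₁(0,m+1) = B` agree,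
then `∑_{q ≤ m+2} (-1)^q s(m+2-q, q) = -2 ∑_{q ≤ m} (-1)^q p(m-q, q)` (the `s₁`-terms cancel in
pairs up to the boundary terms, which cancel the two extreme terms of the left side). [folklore] -/
theorem alternating_sum_succ_succ (s s₁ p : ℕ → ℕ → ℝ) (B : ℝ) (m : ℕ)
    (hrec : ∀ a b, s (a + 1) (b + 1) = s₁ a (b + 1) + s₁ (a + 1) b + 2 * p a b)
    (hb1 : s (m + 2) 0 = B) (hb2 : s 0 (m + 2) = B) (hb3 : s₁ (m + 1) 0 = B)
    (hb4 : s₁ 0 (m + 1) = B) :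
    ∑ q ∈ Finset.range (m + 2 + 1), (-1 : ℝ) ^ q * s (m + 2 - q) q =
      -2 * ∑ q ∈ Finset.range (m + 1), (-1 : ℝ) ^ q * p (m - q) q := by
  set W := ∑ q ∈ Finset.range (m + 1 + 1), (-1 : ℝ) ^ q * s₁ (m + 1 - q) q with hW
  have hU : W = -(∑ q ∈ Finset.range (m + 1), (-1 : ℝ) ^ q * s₁ (m - q) (q + 1)) + B := by
    rw [hW, Finset.sum_range_succ']
    simp only [Nat.add_sub_add_right, Nat.sub_zero, pow_zero, one_mul, hb3, pow_succ, mul_neg_one,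
      neg_mul, Finset.sum_neg_distrib]
  have hV : W = ∑ q ∈ Finset.range (m + 1), (-1 : ℝ) ^ q * s₁ (m + 1 - q) q - (-1) ^ m * B := by
    rw [hW, Finset.sum_range_succ, Nat.sub_self, hb4, pow_succ]
    ring
  rw [Finset.sum_range_succ, Finset.sum_range_succ']
  simp only [Nat.sub_zero, Nat.sub_self, pow_zero, one_mul, hb1, hb2]
  have h3 : ∀ q ∈ Finset.range (m + 1), (-1 : ℝ) ^ (q + 1) * s (m + 2 - (q + 1)) (q + 1) =
      -((-1 : ℝ) ^ q * (s₁ (m - q) (q + 1) + s₁ (m + 1 - q) q + 2 * p (m - q) q)) := by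
    intro q hq
    rw [Finset.mem_range] at hq
    rw [show m + 2 - (q + 1) = m - q + 1 by omega, hrec, show m - q + 1 = m + 1 - q by omega,
      pow_succ]
    ring
  rw [Finset.sum_congr rfl h3, Finset.sum_neg_distrib]
  simp only [mul_add, Finset.sum_add_distrib]
  have hUV : ∑ q ∈ Finset.range (m + 1), (-1 : ℝ) ^ q * s₁ (m - q) (q + 1) +
      ∑ q ∈ Finset.range (m + 1), (-1 : ℝ) ^ q * s₁ (m + 1 - q) q = B + (-1) ^ m * B := by
    linear_combination hU - hV
  have hp : ∑ x ∈ Finset.range (m + 1), (-1 : ℝ) ^ x * (2 * p (m - x) x) =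
      2 * ∑ q ∈ Finset.range (m + 1), (-1 : ℝ) ^ q * p (m - q) q := by
    rw [Finset.mul_sum]
    exact Finset.sum_congr rfl fun q _ => by ring
  linear_combination -hUV - hp

/-- **`σ_{m+2} = -4 A²B² σ_m`**:
`∑_{q ≤ m+2} (-1)^q [(AB)^{m+2-q} ш (AB)^q] = -4 ∑_{q ≤ m} (-1)^q A²B²[(AB)^{m-q} ш (AB)^q]`.
[cite: BBBL1998, §4 Corollary 1] -/
theorem sum_alternating_S_succ_succ (m : ℕ) :
    ∑ q ∈ Finset.range (m + 2 + 1), (-1 : ℝ) ^ q *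
        ((shuffleWord (binaryWord (List.replicate (m + 2 - q) 2))
          (binaryWord (List.replicate q 2))).map f).sum =
      -4 * ∑ q ∈ Finset.range (m + 1), (-1 : ℝ) ^ q *
          ((shuffleWord (binaryWord (List.replicate (m - q) 2))
            (binaryWord (List.replicate q 2))).map
              (f ∘ List.cons false ∘ List.cons false ∘ List.cons true ∘ List.cons true)).sum := by
  have h := alternating_sum_succ_succ
    (fun a b => ((shuffleWord (binaryWord (List.replicate a 2)) (binaryWord (List.replicate b 2))).map f).sum)
    (fun a b => ((shuffleWord (binaryWord (List.replicate a 2)) (binaryWord (List.replicate b 2))).map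
      (f ∘ List.cons false ∘ List.cons true)).sum)
    (fun a b => ((shuffleWord (true :: binaryWord (List.replicate a 2))
      (true :: binaryWord (List.replicate b 2))).map (f ∘ List.cons false ∘ List.cons false)).sum)
    (f (binaryWord (List.replicate (m + 2) 2))) m
    (fun a b => sum_shuffleWord_twos_succ_succ f a b)
    (by simp [binaryWord]) (by simp [binaryWord])
    (by simp [binaryWord, binaryWord_replicate_two_succ])
    (by simp [binaryWord, binaryWord_replicate_two_succ])
  rw [h, sum_alternating_P (f ∘ List.cons false ∘ List.cons false) m]
  simp only [Function.comp_assoc]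
  ring

/-- `σ₀ = 1`: `∑_{q ≤ 0} (-1)^q [(AB)^{0-q} ш (AB)^q] = f(∅)`. [folklore] -/
theorem sum_alternating_S_zero :
    ∑ q ∈ Finset.range (0 + 1), (-1 : ℝ) ^ q *
        ((shuffleWord (binaryWord (List.replicate (0 - q) 2))
          (binaryWord (List.replicate q 2))).map f).sum = f [] := by
  simp [binaryWord]

/-- **Corollary 1 of [BBBL1998, §4]** (`σ_{2n} = (-4)ⁿ (A²B²)ⁿ`): for every `f`,
`∑_{q=0}^{2n} (-1)^q ∑_{W ∈ (AB)^{2n-q} ш (AB)^q} f(W) = (-4)ⁿ f((A²B²)ⁿ)`, i.e.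
`∑_{r=-n}^{n} (-1)ʳ (AB)^{n-r} ш (AB)^{n+r} = 4ⁿ (A²B²)ⁿ` in the shuffle algebra `ℚ⟨A,B⟩`
(`(AB)ᵖ = ε({2}ᵖ)`, `(A²B²)ⁿ = ε({3,1}ⁿ)`). [cite: BBBL1998, §4 Corollary 1] -/
theorem sum_shuffleWord_twos_alternating (n : ℕ) : ∀ f : List Bool → ℝ,
    ∑ q ∈ Finset.range (2 * n + 1), (-1 : ℝ) ^ q *
        ((shuffleWord (binaryWord (List.replicate (2 * n - q) 2))
          (binaryWord (List.replicate q 2))).map f).sum =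
      (-4 : ℝ) ^ n * f (binaryWord (List.replicate n [3, 1]).flatten) := by
  induction n with
  | zero =>
    intro f
    rw [Nat.mul_zero, sum_alternating_S_zero, pow_zero, one_mul]
    rfl
  | succ n ih =>
    intro f
    rw [show 2 * (n + 1) = 2 * n + 2 by ring, sum_alternating_S_succ_succ f (2 * n),
      ih (f ∘ List.cons false ∘ List.cons false ∘ List.cons true ∘ List.cons true),
      binaryWord_threeOne_succ]
    simp only [Function.comp_apply]
    ring

end ShuffleSums

end MZV

open MZV

/-! ### From the shuffle algebra to multiple zeta values -/

/-- The entries of `{3,1}ⁿ` are positive. [folklore] -/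
theorem one_le_of_mem_threeOne (n : ℕ) : ∀ i ∈ (List.replicate n [3, 1]).flatten, 1 ≤ i := by
  intro i hi
  rw [List.mem_flatten] at hi
  obtain ⟨l, hl, hil⟩ := hi
  rw [List.eq_of_mem_replicate hl] at hil
  simp only [List.mem_cons, List.not_mem_nil, or_false] at hil
  omega

/-- `{3,1}ⁿ` is admissible. [folklore] -/
theorem isAdmissible_threeOne (n : ℕ) : IsAdmissible (List.replicate n [3, 1]).flatten := by
  refine ⟨one_le_of_mem_threeOne n, fun h => ?_⟩
  cases n with
  | zero => exact absurd rfl h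
  | succ n => simp [threeOne_succ]

/-- `{3,1}ⁿ` has weight `4n`. [folklore] -/
theorem weight_threeOne (n : ℕ) : weight (List.replicate n [3, 1]).flatten = 4 * n := by
  induction n with
  | zero => rfl
  | succ n ih =>
    rw [threeOne_succ]
    simp only [weight, List.sum_cons] at ih ⊢
    rw [ih]
    ring

/-- **[BBBL1998, §6, first display]**: the shuffle product formula for iterated integrals turns
Corollary 1 into `∑_{q=0}^{2n} (-1)^q ζ({2}^{2n-q}) ζ({2}^q) = (-4)ⁿ ζ({3,1}ⁿ)`, i.e.
`∑_{r=-n}^{n} (-1)ʳ ζ({2}^{n-r}) ζ({2}^{n+r}) = 4ⁿ ζ({3,1}ⁿ)`.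
[cite: BBBL1998, §6 proof of Theorem 1] -/
theorem sum_multipleZeta_twos_alternating (n : ℕ) :
    ∑ q ∈ Finset.range (2 * n + 1), (-1 : ℝ) ^ q *
        (multipleZeta (List.replicate (2 * n - q) 2) * multipleZeta (List.replicate q 2)) =
      (-4 : ℝ) ^ n * multipleZeta (List.replicate n [3, 1]).flatten := by
  have h := sum_shuffleWord_twos_alternating n fun W => multipleZeta (ofBinaryWord W)
  rw [ofBinaryWord_binaryWord (one_le_of_mem_threeOne n)] at h
  rw [← h]
  refine Finset.sum_congr rfl fun q _ => ?_
  rw [multipleZeta_mul_eq_sum_shuffleWord (isAdmissible_replicate_two _)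
    (isAdmissible_replicate_two _)]

/-! ### The factorial identity ([BBBL1998], Lemma 1) -/

/-- Splitting a sum over `range (2M)` into even and odd indices. [folklore] -/
theorem sum_range_two_mul {M : Type*} [AddCommMonoid M] (g : ℕ → M) (n : ℕ) :
    ∑ k ∈ Finset.range (2 * n), g k = ∑ j ∈ Finset.range n, (g (2 * j) + g (2 * j + 1)) := by
  induction n with
  | zero => simp
  | succ n ih =>
    rw [show 2 * (n + 1) = 2 * n + 1 + 1 by ring, Finset.sum_range_succ, Finset.sum_range_succ, ih,
      Finset.sum_range_succ, add_assoc]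

/-- **[BBBL1998], Lemma 1** in binomial form: `∑_{q=0}^{2n} (-1)^q C(4n+2, 2q+1) = (-1)ⁿ 2^{2n+1}`
(the imaginary part of `(1+i)^{4n+2} = (2i)^{2n+1}`); equivalently
`∑_{r=-n}^{n} (-1)ʳ/((2n+2r+1)!(2n-2r+1)!) = 2^{2n+1}/(4n+2)!`. [cite: BBBL1998, Lemma 1] -/
theorem sum_neg_one_pow_mul_choose_odd (n : ℕ) :
    ∑ q ∈ Finset.range (2 * n + 1), (-1 : ℝ) ^ q * (Nat.choose (4 * n + 2) (2 * q + 1) : ℝ) =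
      (-1) ^ n * 2 ^ (2 * n + 1) := by
  -- `(I + 1)^(4n+2) = 2^(2n+1) (-1)^n I`
  have hL : (Complex.I + 1) ^ (4 * n + 2) = 2 ^ (2 * n + 1) * (-1) ^ n * Complex.I := by
    have h2 : (Complex.I + 1) ^ 2 = 2 * Complex.I := by
      rw [add_sq, Complex.I_sq]; ring
    have hI : Complex.I ^ (2 * n + 1) = (-1) ^ n * Complex.I := by
      rw [pow_succ, pow_mul, Complex.I_sq]
    calc (Complex.I + 1) ^ (4 * n + 2) = ((Complex.I + 1) ^ 2) ^ (2 * n + 1) := by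
          rw [← pow_mul]; ring_nf
      _ = (2 * Complex.I) ^ (2 * n + 1) := by rw [h2]
      _ = 2 ^ (2 * n + 1) * Complex.I ^ (2 * n + 1) := mul_pow _ _ _
      _ = 2 ^ (2 * n + 1) * ((-1) ^ n * Complex.I) := by rw [hI]
      _ = 2 ^ (2 * n + 1) * (-1) ^ n * Complex.I := by ring
  -- binomial expansion and imaginary parts
  have hB := add_pow Complex.I 1 (4 * n + 2)
  have hI := congrArg Complex.im (hL.symm.trans hB)
  rw [Complex.im_sum, show 4 * n + 2 + 1 = 2 * (2 * n + 1) + 1 by ring, Finset.sum_range_succ,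
    sum_range_two_mul] at hI
  have he : ∀ j : ℕ, (Complex.I ^ (2 * j) * 1 ^ (4 * n + 2 - 2 * j) *
      (Nat.choose (4 * n + 2) (2 * j) : ℂ)).im = 0 := by
    intro j
    rw [pow_mul, Complex.I_sq, one_pow, mul_one, show ((-1 : ℂ)) ^ j * (Nat.choose (4 * n + 2) (2 * j) : ℂ)
      = (((-1 : ℝ) ^ j * Nat.choose (4 * n + 2) (2 * j) : ℝ) : ℂ) by push_cast; ring]
    exact Complex.ofReal_im _
  have ho : ∀ j : ℕ, (Complex.I ^ (2 * j + 1) * 1 ^ (4 * n + 2 - (2 * j + 1)) *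
      (Nat.choose (4 * n + 2) (2 * j + 1) : ℂ)).im = (-1) ^ j * Nat.choose (4 * n + 2) (2 * j + 1) := by
    intro j
    rw [pow_succ, pow_mul, Complex.I_sq, one_pow, mul_one,
      show ((-1 : ℂ)) ^ j * Complex.I * (Nat.choose (4 * n + 2) (2 * j + 1) : ℂ) =
        (((-1 : ℝ) ^ j * Nat.choose (4 * n + 2) (2 * j + 1) : ℝ) : ℂ) * Complex.I by push_cast; ring,
      Complex.im_ofReal_mul, Complex.I_im, mul_one]
  simp only [he, ho, zero_add, add_zero] at hI
  have hlhs : (2 ^ (2 * n + 1) * (-1) ^ n * Complex.I : ℂ).im = 2 ^ (2 * n + 1) * (-1) ^ n := by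
    rw [show (2 ^ (2 * n + 1) * (-1) ^ n * Complex.I : ℂ) =
      ((2 ^ (2 * n + 1) * (-1) ^ n : ℝ) : ℂ) * Complex.I by push_cast; ring,
      Complex.im_ofReal_mul, Complex.I_im, mul_one]
  rw [hlhs] at hI
  rw [← hI]
  ring

/-- [BBBL1998], Lemma 1 in factorial form over `q = 0, …, 2n` (`r = q - n`):
`∑_{q=0}^{2n} (-1)^q / ((4n-2q+1)! (2q+1)!) = (-1)ⁿ 2^{2n+1} / (4n+2)!`. [cite: BBBL1998, Lemma 1] -/
theorem sum_neg_one_pow_div_factorial (n : ℕ) :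
    ∑ q ∈ Finset.range (2 * n + 1),
        (-1 : ℝ) ^ q / ((Nat.factorial (4 * n - 2 * q + 1) : ℝ) * (Nat.factorial (2 * q + 1) : ℝ)) =
      (-1) ^ n * 2 ^ (2 * n + 1) / (Nat.factorial (4 * n + 2) : ℝ) := by
  rw [← sum_neg_one_pow_mul_choose_odd, Finset.sum_div]
  refine Finset.sum_congr rfl fun q hq => ?_
  rw [Finset.mem_range] at hq
  rw [Nat.cast_choose ℝ (show 2 * q + 1 ≤ 4 * n + 2 by omega),
    show 4 * n + 2 - (2 * q + 1) = 4 * n - 2 * q + 1 by omega]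
  have h1 : (Nat.factorial (4 * n + 2) : ℝ) ≠ 0 := by positivity
  have h2 : (Nat.factorial (4 * n - 2 * q + 1) : ℝ) ≠ 0 := by positivity
  have h3 : (Nat.factorial (2 * q + 1) : ℝ) ≠ 0 := by positivity
  field_simp

/-! ### The Zagier–Broadhurst evaluation -/

/-- **Borwein–Bradley–Broadhurst–Lisoněk 1998, Theorem 1 (the Zagier conjecture)**: for every `n`,
`ζ({3,1}ⁿ) = ζ(3,1,3,1,…,3,1) = 2 π⁴ⁿ / (4n+2)!` (conjectured by Zagier, ECM 1992, §9; first
proved by Borwein–Bradley–Broadhurst–Lisoněk, "the first non-commutative extension of Euler's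
evaluation of `ζ(2n)`"). Proof: [BBBL1998, §6] — the shuffle identity
`sum_multipleZeta_twos_alternating`, `ζ({2}ᵏ) = π^{2k}/(2k+1)!` and Lemma 1.
[cite: BBBL1998, §6 Theorem 1] -/
theorem multipleZeta_threeOne (n : ℕ) :
    multipleZeta (List.replicate n [3, 1]).flatten = 2 * π ^ (4 * n) / (Nat.factorial (4 * n + 2) : ℝ) := by
  have h := sum_multipleZeta_twos_alternating n
  have hq : ∀ q ∈ Finset.range (2 * n + 1), (-1 : ℝ) ^ q *
      (multipleZeta (List.replicate (2 * n - q) 2) * multipleZeta (List.replicate q 2)) =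
      π ^ (4 * n) * ((-1 : ℝ) ^ q /
        ((Nat.factorial (4 * n - 2 * q + 1) : ℝ) * (Nat.factorial (2 * q + 1) : ℝ))) := by
    intro q hq
    rw [Finset.mem_range] at hq
    rw [multipleZeta_replicate_two, multipleZeta_replicate_two,
      show 2 * (2 * n - q) + 1 = 4 * n - 2 * q + 1 by omega,
      show π ^ (4 * n) = π ^ (2 * (2 * n - q)) * π ^ (2 * q) by rw [← pow_add]; congr 1; omega]
    have h2 : (Nat.factorial (4 * n - 2 * q + 1) : ℝ) ≠ 0 := by positivity
    have h3 : (Nat.factorial (2 * q + 1) : ℝ) ≠ 0 := by positivity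
    field_simp
  rw [Finset.sum_congr rfl hq, ← Finset.mul_sum, sum_neg_one_pow_div_factorial] at h
  -- `h : π^{4n} ((-1)ⁿ 2^{2n+1}/(4n+2)!) = (-4)ⁿ ζ({3,1}ⁿ)`
  have h4 : (-4 : ℝ) ^ n = (-1) ^ n * 2 ^ (2 * n) := by
    rw [pow_mul, ← mul_pow]; norm_num
  rw [h4] at h
  have key : (-1 : ℝ) ^ n * 2 ^ (2 * n) * multipleZeta (List.replicate n [3, 1]).flatten =
      (-1 : ℝ) ^ n * 2 ^ (2 * n) * (2 * π ^ (4 * n) / (Nat.factorial (4 * n + 2) : ℝ)) := by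
    rw [← h]
    ring
  exact mul_left_cancel₀ (mul_ne_zero (pow_ne_zero _ (by norm_num)) (pow_ne_zero _ two_ne_zero)) key

/-- `ζ({3,1}ⁿ) ∈ ℚ π⁴ⁿ`. [cite: BBBL1998, §6 Theorem 1] -/
theorem multipleZeta_threeOne_mem_span_pi_pow (n : ℕ) :
    multipleZeta (List.replicate n [3, 1]).flatten ∈ Submodule.span ℚ {π ^ (4 * n)} := by
  rw [Submodule.mem_span_singleton]
  refine ⟨2 / (Nat.factorial (4 * n + 2) : ℚ), ?_⟩
  rw [multipleZeta_threeOne, Rat.smul_def]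
  push_cast
  ring

/-- **`ζ(3,1,…,3,1) ∈ hoffmanSpan (4n)`** for every `n` — Brown's theorem `hoffmanSpan_eq_mzvSpace`
(Theorem 1.1) for the family `ζ({3,1}ⁿ)` (which are not Hoffman elements), in all weights:
`ζ({3,1}ⁿ) = 2π⁴ⁿ/(4n+2)! = (2 (4n+1)!/(4n+2)!) ζ({2}²ⁿ)`. [cite: Brown2012, Theorem 1.1] -/
theorem multipleZeta_threeOne_mem_hoffmanSpan (n : ℕ) :
    multipleZeta (List.replicate n [3, 1]).flatten ∈ hoffmanSpan (4 * n) := by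
  have h := multipleZeta_threeOne_mem_span_pi_pow n
  rw [show 4 * n = 2 * (2 * n) by ring] at h ⊢
  exact span_pi_pow_le_hoffmanSpan (2 * n) h

/-- The weight-space form: `ζ({3,1}ⁿ) ∈ hoffmanSpan (weight {3,1}ⁿ)`. [cite: Brown2012, Theorem 1.1] -/
theorem multipleZeta_threeOne_mem_hoffmanSpan_weight (n : ℕ) :
    multipleZeta (List.replicate n [3, 1]).flatten ∈
      hoffmanSpan (weight (List.replicate n [3, 1]).flatten) := by
  rw [weight_threeOne]
  exact multipleZeta_threeOne_mem_hoffmanSpan n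

/-- `ζ({3,1}ⁿ) = (2 (4n+1)!·(2·2n+1)!/(4n+2)!) …`: explicitly, `ζ({3,1}ⁿ) (4n+2) = 2 (4n+1) … ` — the
simplest relation with the Hoffman element of the same weight: `(2n+1)·C(4n+2,2n+1) ζ({3,1}ⁿ) = …`;
we record the clean form `(4n+2)! ζ({3,1}ⁿ) = 2 (4n+1)! ζ({2}²ⁿ)`. [cite: BBBL1998, §6 Theorem 1] -/
theorem factorial_mul_multipleZeta_threeOne (n : ℕ) :
    (Nat.factorial (4 * n + 2) : ℝ) * multipleZeta (List.replicate n [3, 1]).flatten =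
      2 * (Nat.factorial (4 * n + 1) : ℝ) * multipleZeta (List.replicate (2 * n) 2) := by
  rw [multipleZeta_threeOne, multipleZeta_replicate_two, show 2 * (2 * n) = 4 * n by ring]
  have h1 : (Nat.factorial (4 * n + 2) : ℝ) ≠ 0 := by positivity
  have h2 : (Nat.factorial (4 * n + 1) : ℝ) ≠ 0 := by positivity
  field_simp

end Literature.NumberTheory.Transcendental
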